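import Literature.MathematicalPhysics.QuantumFieldTheory.Balaban1983to89.Node00.LocalizedSum17

/-!
# NODE 00 ∕ W1 — NAMED LETTERS FOR NODE U3's KERNEL INPUTS: (1.21)-existence on the window, windowed finite-volume joint history-Lipschitz
# bounds, windowed (5.10) decay, geometric increments in the volume — as DISPLAYED `Prop`s, with their record editions and estimate-free transfers

Seat `pub-ymgap-node00-def-W1` g29 (DEFINER; Literature side, hypothesis-schema style, D-0064), append-only sibling of `Node00/U3OfKernels` (W1-19) and
`Node00/LocalizedSum17` (W1-20).  Plan ruling of record (seat `pub-ymgap-plan` g81 № 13, 2026-08-28): YES by name; consumer shapes VERBATIM (nodes N22 ∕ N18 ∕ N27 producers at the kernel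
objects of record); `κ ∕ Λ ∕ θ ∕ C` free parameters.

## Why

`Node00/U3OfKernels` names node U3's OUTPUT-side (5.10) clause of record (`KernelDecayOfRecord₁₃`, the (D4) letter).  The Summit-side producers at the kernel
objects of record (`objectsOfRecord₁₃`) display their INPUTS as raw hypotheses — the existence of the (1.21) limits on the window ([I] p. 264 «This limit exists by
the localized representation (1.7)») and finite-volume bounds on def-B's windowed kernels `Node00.polWindow`, holding eventually in the volume index `K`, from which
the limiting kernels inherit NE9 ∕ (5.10) by `le_of_tendsto`.  This file gives those inputs NAMES, generic and at the record, so that every seat cites ONE letter: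

* §1 (generic, over a term family `ℰ : Node00.TermFamily1 F 𝔄`, a probe `ρ`, a basis `bV`, a window `W`):
  - `PolLimitsExist F ℰ ρ bV W` — (1.21) EXISTS at every history of the window and every level (def-B's `PolLimitExists`, quantified);
  - `WindowedNE9 F ℰ ρ bV W κ Λ` — the JOINT HISTORY-LIPSCHITZ bound on the windowed kernels of level `k + 1` at two coupling sequences of `W`, modulus
    `e^{−κ|z|₁} Σ_{i<k+1} Λ (k+1) i |g_i − g'_i|`, EVENTUALLY in `K` (NE9 at finite volume — NOT PRINTED for d = 4; [I] (1.18) p. 263 is the value-level decay); its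
    `∀ K` form `WindowedNE9Forall`;
  - `WindowedDecay F ℰ ρ bV W μ ν κ` — the windowed (5.10) decay `|Π^{(K)}_{k+1,μν}(g; z)| ≤ C₀ e^{−κ|z|₁}` eventually in `K`, ONE constant per `g ∈ W` uniform in `k`
    (right-hand side aligned to `B12Sec2to5.Decay510`);
  - `GeometricIncrements F ℰ ρ bV W r` — the finite-volume STABILISATION `|Π^{(K+1)} − Π^{(K)}| ≤ C r^K` from some `K₀` on (the mechanism behind (1.21)'s existence, [I] p. 264);
  - BOX forms (node N18's producer reads box histories `v ∈ ]0, γ]^{k+1}`, not window prefixes): `PolLimitsExistBox F ℰ ρ bV γ` (+ `PolLimitsExist.box`, window ⇒ box)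
    and the WINDOWED TWO-RUN STEP RATE `WindowedStepRate F ℰ ρ bV γ s κ θ₅ C₅` — run B at approximation `K + s`, level `k + 2`, history `w` against run A at
    approximation `K`, level `k + 1`, history `tail w`, eventually `C' θ^k e^{−κ|x|₁}`-close ([I] Thm 1 p. 259 read at finite volume — NOT PRINTED in this form);
  - the LIMITING-kernel input of node N18: `KernelStepRate F ℰ ρ bV γ κ θ C₅` — `|Π_k(g) − Π_{k+1}(b, g)| ≤ C₅ θ^{k+1} e^{−κ|z|₁}` for every member `b ∈ ]0, γ]`
    and every `g` of the window, i.e. W1-19's `NE5 (EA …) (EB … b)` for all `b` (`kernelStepRate_iff_forall_ne5`);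
  each with its `Iff.rfl` face, and the ESTIMATE-FREE TRANSFERS under W1-20's `LocalizedSum17.EventuallyAgree F ℰ ℰ'` (two term families equal for all large `K`):
  the windowed kernel sequences are eventually equal (`polWindow_eventuallyEq_of_eventuallyAgree`), so each letter transfers (`…_iff_of_eventuallyAgree`:
  `Filter.tendsto_congr'` ∕ `Filter.eventually_congr` ∕ an index shift) — no convergence used or claimed.
* §2 (at the record, Stage 13): the editions `PolLimitsExistOfRecord₁₃ F N θ`, `WindowedNE9OfRecord₁₃ F N θ κ Λ` (+ `WindowedNE9ForallOfRecord₁₃`),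
  `WindowedDecayOfRecord₁₃ F N θ μ ν κ`, `GeometricIncrementsOfRecord₁₃ F N θ r`, `PolLimitsExistBoxOfRecord₁₃ F N θ` (+ `PolLimitsExistOfRecord₁₃.box`),
  `WindowedStepRateOfRecord₁₃ F N θ s κ θ₅ C'`, `KernelStepRateOfRecord₁₃ F N θ κ θ₅ C₅` (+ `_iff_forall_ne5`) at the MERGED TERM FAMILY OF RECORD `mergedTermFamilyMatT F N (TβOfRecord₁₃ F N) (chiβOfRecord₁₃ F N θ) θ.εbg` in the record's
  β-chart `θ.ρ8 ∕ θ.bV` (instances bound by `letI` exactly as in `U3OfKernels.objectsOfRecord₁₃`) on the window `]0, θ.γ]^ℕ`; their `Iff.rfl` faces, whose right-hand sides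
  ARE the raw hypotheses the Summit-side kernel producers display; and the READING-SIDE faces `…OfRecord₁₃_iff_of_localizes`: under W1-20's law
  `Localizes17OfRecord₁₃ F N θ S emb` each letter of record ⟺ the same letter at the W1 reading's localized sum `localizedSum F S emb`.

## HONEST LIMITS

Binders (`Prop`-valued definitions), `Iff.rfl` faces and filter-congruence bookkeeping ONLY.  No letter is inhabited here; no passage theorem (the `le_of_tendsto`
steps from the windowed letters to NE9 ∕ (5.10) of the limiting kernels are the Summit side's); no estimate of print is proved or asserted — the windowed bounds
are the CONTENT of [I] §1 ∕ §5 ((1.18), (5.10)) carried through the cluster expansion, and the existence (1.21) is a theorem of [I]–[III] typed elsewhere as a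
displayed property (`Node00.PolLimitExists`).  Count-neutral; no node of the record is discharged; no inhabitant of the record is claimed; one finite-torus programme
at fixed lattice spacing — nothing continuum, nothing about a mass gap.

## CITATION HEADER (D-0065)
- [I] = T. Bałaban, Renormalization group approach to lattice gauge field theories. I., Comm. Math. Phys. 109 (1987) 249–301 [Balaban1987RG1]: Thm 1 p. 259; (1.18) p. 263;
  (1.20)–(1.21) p. 264 «uniformly bounded on the domain (1.19) together with all derivatives … This limit exists by the localized representation (1.7)»; (5.10) p. 293.
- [II] = T. Bałaban, Renormalization group approach to lattice gauge field theories. II. Cluster expansions, Comm. Math. Phys. 116 (1988) 1–22 [Balaban1988RG2Cluster]: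
  (2.13)–(2.14) pp. 14–15 (the terms whose localized sum W1-20 types; the reading-side faces of §2).
- Pages read from the materialised text `paper:balaban1987-cmp109-rg-i-small-field` pp. 263–264 (journal pagination) this generation.

Typer lint: no `instance`, no `notation`, no attribute removal, no `sorry`; imports `Node00.LocalizedSum17` only (⊇ `Node00.U3OfKernels`, `Node00.BetaOfRecord`);
nothing re-declared (`PolLimitExists ∕ polWindow ∕ histPrefix ∕ kernelA ∕ EA ∕ EB ∕ NE5 ∕ prependCoupling ∕ extd ∕ Box ∕ EventuallyAgree ∕ Localizes17OfRecord₁₃` cited by name).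
-/

open scoped BigOperators

namespace Literature.MathematicalPhysics.QuantumFieldTheory.Balaban1983to89.Node00.U3KernelLetters

open Filter
open T4Continuum (T4Family)
open T4OutputRate (Window NE5)
open B12Sec2to5 (l1)
open FlowStep (Box)
open T4FlagMemory (extd)
open T4BetaReadOut (extd_mem_window)
open U3OfKernels (histPrefix kernelA EA EB)
open LocalizedSum17 (EventuallyAgree localizedSum ReadingMaps Localizes17OfRecord₁₃)
open W1 (ClusterTower)

/-! ## §1. The letters, generic over a term family -/

section Generic

variable {𝔄 : Type*} [NormedRing 𝔄] [NormedAlgebra ℝ 𝔄]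
variable {V : Type*} [NormedAddCommGroup V] [NormedSpace ℝ V] {ι : Type*} [Fintype ι]
variable (F : T4Family) (ℰ : TermFamily1 F 𝔄) (ρ : V →L[ℝ] 𝔄) (bV : Module.Basis ι ℝ V)

/-- **(1.21) EXISTS ON THE WINDOW** (binder): at every coupling sequence `g` of the window `W` and every level `k`, the windowed finite-volume kernels of
`ℰ k (g_0, …, g_k) K` converge as `K → ∞` — def-B's `Node00.PolLimitExists`, quantified over the window. [cite: Balaban1987RG1, (1.21) p.264] -/
def PolLimitsExist (W : Set (ℕ → ℝ)) : Prop :=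
  ∀ g ∈ W, ∀ k : ℕ, PolLimitExists F (k + 1) (fun K => ℰ k (histPrefix g k) K) ρ bV

/-- Face (`Iff.rfl`). [cite: Balaban1987RG1, (1.21) p.264 (bookkeeping)] -/
theorem polLimitsExist_iff (W : Set (ℕ → ℝ)) :
    PolLimitsExist F ℰ ρ bV W ↔ ∀ g ∈ W, ∀ k : ℕ, PolLimitExists F (k + 1) (fun K => ℰ k (histPrefix g k) K) ρ bV := Iff.rfl

/-- **WINDOWED NE9** (binder): the joint history-Lipschitz bound on the WINDOWED finite-volume kernels of level `k + 1` at two coupling sequences of `W`, with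
modulus `e^{−κ|z|₁} Σ_{i<k+1} Λ (k+1) i |g_i − g'_i|`, holding EVENTUALLY in the volume index `K`.  NE9 at finite volume is NOT PRINTED for d = 4 (the value-level
decay is [I] (1.18) p. 263); a displayed hypothesis of the kernel producers. [cite: Balaban1987RG1, (1.18) p.263 and (1.20) p.264] -/
def WindowedNE9 (W : Set (ℕ → ℝ)) (κ : ℝ) (Λ : ℕ → ℕ → ℝ) : Prop :=
  ∀ g ∈ W, ∀ g' ∈ W, ∀ (k : ℕ) (μ ν : Fin 4) (z : Fin 4 → ℤ), ∀ᶠ K in atTop,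
    |polWindow F K (k + 1) (ℰ k (histPrefix g k) K) ρ bV μ ν z - polWindow F K (k + 1) (ℰ k (histPrefix g' k) K) ρ bV μ ν z| ≤
      Real.exp (-(κ * l1 z)) * ∑ i ∈ Finset.range (k + 1), Λ (k + 1) i * |g i - g' i|

/-- Face (`Iff.rfl`). [cite: Balaban1987RG1, (1.18) p.263 (bookkeeping)] -/
theorem windowedNE9_iff (W : Set (ℕ → ℝ)) (κ : ℝ) (Λ : ℕ → ℕ → ℝ) :
    WindowedNE9 F ℰ ρ bV W κ Λ ↔ ∀ g ∈ W, ∀ g' ∈ W, ∀ (k : ℕ) (μ ν : Fin 4) (z : Fin 4 → ℤ), ∀ᶠ K in atTop,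
      |polWindow F K (k + 1) (ℰ k (histPrefix g k) K) ρ bV μ ν z - polWindow F K (k + 1) (ℰ k (histPrefix g' k) K) ρ bV μ ν z| ≤
        Real.exp (-(κ * l1 z)) * ∑ i ∈ Finset.range (k + 1), Λ (k + 1) i * |g i - g' i| := Iff.rfl

/-- **WINDOWED NE9, `∀ K` FORM** (binder): the same bound at EVERY volume index. [cite: Balaban1987RG1, (1.18) p.263 and (1.20) p.264] -/
def WindowedNE9Forall (W : Set (ℕ → ℝ)) (κ : ℝ) (Λ : ℕ → ℕ → ℝ) : Prop :=
  ∀ g ∈ W, ∀ g' ∈ W, ∀ (K k : ℕ) (μ ν : Fin 4) (z : Fin 4 → ℤ),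
    |polWindow F K (k + 1) (ℰ k (histPrefix g k) K) ρ bV μ ν z - polWindow F K (k + 1) (ℰ k (histPrefix g' k) K) ρ bV μ ν z| ≤
      Real.exp (-(κ * l1 z)) * ∑ i ∈ Finset.range (k + 1), Λ (k + 1) i * |g i - g' i|

/-- Face (`Iff.rfl`). [cite: Balaban1987RG1, (1.18) p.263 (bookkeeping)] -/
theorem windowedNE9Forall_iff (W : Set (ℕ → ℝ)) (κ : ℝ) (Λ : ℕ → ℕ → ℝ) :
    WindowedNE9Forall F ℰ ρ bV W κ Λ ↔ ∀ g ∈ W, ∀ g' ∈ W, ∀ (K k : ℕ) (μ ν : Fin 4) (z : Fin 4 → ℤ),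
      |polWindow F K (k + 1) (ℰ k (histPrefix g k) K) ρ bV μ ν z - polWindow F K (k + 1) (ℰ k (histPrefix g' k) K) ρ bV μ ν z| ≤
        Real.exp (-(κ * l1 z)) * ∑ i ∈ Finset.range (k + 1), Λ (k + 1) i * |g i - g' i| := Iff.rfl

/-- The `∀ K` form gives the eventual form. [cite: Balaban1987RG1, (1.18) p.263 (bookkeeping)] -/
theorem WindowedNE9Forall.windowedNE9 {W : Set (ℕ → ℝ)} {κ : ℝ} {Λ : ℕ → ℕ → ℝ} (h : WindowedNE9Forall F ℰ ρ bV W κ Λ) :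
    WindowedNE9 F ℰ ρ bV W κ Λ := fun g hg g' hg' k μ ν z => Eventually.of_forall fun K => h g hg g' hg' K k μ ν z

/-- **WINDOWED (5.10) DECAY** (binder): `|Π^{(K)}_{k+1,μν}(g; z)| ≤ C₀ e^{−κ|z|₁}` eventually in `K`, ONE constant per coupling sequence of the window, uniform in the
level (right-hand side aligned to `B12Sec2to5.Decay510`). [cite: Balaban1987RG1, (5.10) p.293 and (1.20) p.264] -/
def WindowedDecay (W : Set (ℕ → ℝ)) (μ ν : Fin 4) (κ : ℝ) : Prop :=
  ∀ g ∈ W, ∃ C₀ : ℝ, ∀ (k : ℕ) (z : Fin 4 → ℤ), ∀ᶠ K in atTop, |polWindow F K (k + 1) (ℰ k (histPrefix g k) K) ρ bV μ ν z| ≤ C₀ * Real.exp (-κ * l1 z)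

/-- Face (`Iff.rfl`). [cite: Balaban1987RG1, (5.10) p.293 (bookkeeping)] -/
theorem windowedDecay_iff (W : Set (ℕ → ℝ)) (μ ν : Fin 4) (κ : ℝ) :
    WindowedDecay F ℰ ρ bV W μ ν κ ↔ ∀ g ∈ W, ∃ C₀ : ℝ, ∀ (k : ℕ) (z : Fin 4 → ℤ), ∀ᶠ K in atTop,
      |polWindow F K (k + 1) (ℰ k (histPrefix g k) K) ρ bV μ ν z| ≤ C₀ * Real.exp (-κ * l1 z) := Iff.rfl

/-- **GEOMETRIC INCREMENTS IN THE VOLUME** (binder): from some `K₀` on the windowed kernels of consecutive volume indices differ by `≤ C r^K` — the finite-volume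
STABILISATION behind (1.21)'s existence. [cite: Balaban1987RG1, (1.21) p.264] -/
def GeometricIncrements (W : Set (ℕ → ℝ)) (r : ℝ) : Prop :=
  ∀ g ∈ W, ∀ (k : ℕ) (μ ν : Fin 4) (z : Fin 4 → ℤ), ∃ (K₀ : ℕ) (C : ℝ), ∀ K ≥ K₀,
    |polWindow F (K + 1) (k + 1) (ℰ k (histPrefix g k) (K + 1)) ρ bV μ ν z - polWindow F K (k + 1) (ℰ k (histPrefix g k) K) ρ bV μ ν z| ≤ C * r ^ K

/-- Face (`Iff.rfl`). [cite: Balaban1987RG1, (1.21) p.264 (bookkeeping)] -/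
theorem geometricIncrements_iff (W : Set (ℕ → ℝ)) (r : ℝ) :
    GeometricIncrements F ℰ ρ bV W r ↔ ∀ g ∈ W, ∀ (k : ℕ) (μ ν : Fin 4) (z : Fin 4 → ℤ), ∃ (K₀ : ℕ) (C : ℝ), ∀ K ≥ K₀,
      |polWindow F (K + 1) (k + 1) (ℰ k (histPrefix g k) (K + 1)) ρ bV μ ν z - polWindow F K (k + 1) (ℰ k (histPrefix g k) K) ρ bV μ ν z| ≤
        C * r ^ K := Iff.rfl

/-- **(1.21) EXISTS ON THE BOXES** (binder, BOX form): at every level `k` and every box history `v ∈ ]0, γ]^{k+1}` the windowed finite-volume kernels of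
`ℰ k v K` converge as `K → ∞` (the shape node N18's kernel producer displays). [cite: Balaban1987RG1, (1.21) p.264] -/
def PolLimitsExistBox (γ : ℝ) : Prop :=
  ∀ (k : ℕ) (v : Fin (k + 1) → ℝ), v ∈ Box γ k → PolLimitExists F (k + 1) (fun K => ℰ k v K) ρ bV

/-- Face (`Iff.rfl`). [cite: Balaban1987RG1, (1.21) p.264 (bookkeeping)] -/
theorem polLimitsExistBox_iff (γ : ℝ) :
    PolLimitsExistBox F ℰ ρ bV γ ↔ ∀ (k : ℕ) (v : Fin (k + 1) → ℝ), v ∈ Box γ k → PolLimitExists F (k + 1) (fun K => ℰ k v K) ρ bV := Iff.rfl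

/-- The WINDOW form on `]0, γ]^ℕ` gives the BOX form (`v = histPrefix (extd v) k`, `extd v ∈ Window γ`). [cite: Balaban1987RG1, (1.21) p.264 (bookkeeping)] -/
theorem PolLimitsExist.box {γ : ℝ} (h : PolLimitsExist F ℰ ρ bV (Window γ)) : PolLimitsExistBox F ℰ ρ bV γ := fun k v hv => by
  simpa only [U3OfKernels.histPrefix_extd] using h (extd v) (extd_mem_window hv) k

/-- **WINDOWED TWO-RUN STEP RATE ON THE BOXES** (binder): for every box history `w ∈ ]0, γ]^{k+2}` the finite-volume windowed kernels of run B (approximation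
`K + s`, level `k + 2`, history `w`) and of run A (approximation `K`, level `k + 1`, history `tail w`) are EVENTUALLY IN `K` `(C₅·θ₅·θ₅^k)·e^{−κ|x|₁}`-close
(the shape node N18's kernel producer displays; [I] Thm 1 p. 259 read at finite volume — NOT PRINTED in this form). [cite: Balaban1987RG1, Thm 1 p.259 and (1.20)–(1.21) p.264] -/
def WindowedStepRate (γ : ℝ) (s : ℕ) (κ θ C' : ℝ) : Prop :=
  ∀ (k : ℕ) (w : Fin (k + 2) → ℝ), w ∈ Box γ (k + 1) → ∀ (μ ν : Fin 4) (x : Fin 4 → ℤ), ∀ᶠ K in atTop,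
    |polWindow F (K + s) (k + 1 + 1) (ℰ (k + 1) w (K + s)) ρ bV μ ν x - polWindow F K (k + 1) (ℰ k (Fin.tail w) K) ρ bV μ ν x| ≤
      C' * θ ^ k * Real.exp (-κ * l1 x)

/-- Face (`Iff.rfl`). [cite: Balaban1987RG1, Thm 1 p.259 (bookkeeping)] -/
theorem windowedStepRate_iff (γ : ℝ) (s : ℕ) (κ θ C' : ℝ) :
    WindowedStepRate F ℰ ρ bV γ s κ θ C' ↔ ∀ (k : ℕ) (w : Fin (k + 2) → ℝ), w ∈ Box γ (k + 1) → ∀ (μ ν : Fin 4) (x : Fin 4 → ℤ), ∀ᶠ K in atTop,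
      |polWindow F (K + s) (k + 1 + 1) (ℰ (k + 1) w (K + s)) ρ bV μ ν x - polWindow F K (k + 1) (ℰ k (Fin.tail w) K) ρ bV μ ν x| ≤
        C' * θ ^ k * Real.exp (-κ * l1 x) := Iff.rfl

/-- **KERNEL STEP RATE ON THE WINDOW** (binder, LIMITING kernels): for every unpaired first coupling `b ∈ ]0, γ]` and every `g` of the window, run A's
level-`k` kernel at `g` and its level-`(k+1)` kernel at `(b, g_0, g_1, …)` differ by `≤ C₅ θ^{k+1} e^{−κ|z|₁}` — node N18's INPUT at the kernel objects, i.e.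
W1-19's `NE5 (EA …) (EB … b)` for every member `b` (`kernelStepRate_iff_forall_ne5`). [cite: Balaban1987RG1, Thm 1 p.259 and (1.20)–(1.22) p.264] -/
def KernelStepRate (γ κ θ C₅ : ℝ) : Prop :=
  ∀ b : ℝ, 0 < b → b ≤ γ → ∀ g ∈ Window γ, ∀ (k : ℕ) (μ ν : Fin 4) (z : Fin 4 → ℤ),
    |kernelA F ℰ ρ bV g k μ ν z - kernelA F ℰ ρ bV (prependCoupling b g) (k + 1) μ ν z| ≤ C₅ * θ ^ (k + 1) * Real.exp (-(κ * l1 z))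

/-- Face (`Iff.rfl`). [cite: Balaban1987RG1, Thm 1 p.259 (bookkeeping)] -/
theorem kernelStepRate_iff (γ κ θ C₅ : ℝ) :
    KernelStepRate F ℰ ρ bV γ κ θ C₅ ↔ ∀ b : ℝ, 0 < b → b ≤ γ → ∀ g ∈ Window γ, ∀ (k : ℕ) (μ ν : Fin 4) (z : Fin 4 → ℤ),
      |kernelA F ℰ ρ bV g k μ ν z - kernelA F ℰ ρ bV (prependCoupling b g) (k + 1) μ ν z| ≤ C₅ * θ ^ (k + 1) * Real.exp (-(κ * l1 z)) :=
  Iff.rfl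

/-- The letter IS W1-19's `NE5` of the kernel functionals for every member `b ∈ ]0, γ]` (`U3OfKernels.ne5_iff` per member).
[cite: Balaban1987RG1, Thm 1 p.259 (bookkeeping)] -/
theorem kernelStepRate_iff_forall_ne5 (γ κ θ C₅ : ℝ) :
    KernelStepRate F ℰ ρ bV γ κ θ C₅ ↔ ∀ b : ℝ, 0 < b → b ≤ γ → NE5 (EA F ℰ ρ bV) (EB F ℰ ρ bV b) (Window γ) κ θ C₅ :=
  forall₃_congr fun b _ _ => (U3OfKernels.ne5_iff F ℰ ρ bV b (Window γ) κ θ C₅).symm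

variable {ℰ}

/-- Under W1-20's eventual agreement the windowed kernel sequences of the two term families are EVENTUALLY EQUAL, entry by entry.
[cite: Balaban1987RG1, (1.20)–(1.21) p.264 (bookkeeping)] -/
theorem polWindow_eventuallyEq_of_eventuallyAgree {ℰ ℰ' : TermFamily1 F 𝔄} (h : EventuallyAgree F ℰ ℰ') (g : ℕ → ℝ) (k : ℕ) (μ ν : Fin 4)
    (z : Fin 4 → ℤ) :
    (fun K : ℕ => polWindow F K (k + 1) (ℰ k (histPrefix g k) K) ρ bV μ ν z) =ᶠ[atTop]
      (fun K : ℕ => polWindow F K (k + 1) (ℰ' k (histPrefix g k) K) ρ bV μ ν z) := by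
  obtain ⟨K₀, hK⟩ := h k (histPrefix g k)
  exact Filter.eventually_atTop.2 ⟨K₀, fun K hKK => by simp only [hK K hKK]⟩

/-- `PolLimitsExist` transfers between eventually-agreeing term families (`Filter.tendsto_congr'`; no convergence claimed).
[cite: Balaban1987RG1, (1.21) p.264 (bookkeeping)] -/
theorem polLimitsExist_iff_of_eventuallyAgree {ℰ ℰ' : TermFamily1 F 𝔄} (h : EventuallyAgree F ℰ ℰ') (W : Set (ℕ → ℝ)) :
    PolLimitsExist F ℰ ρ bV W ↔ PolLimitsExist F ℰ' ρ bV W := by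
  refine forall₂_congr fun g _ => forall_congr' fun k => forall₂_congr fun μ ν => forall_congr' fun z => exists_congr fun P => ?_
  exact Filter.tendsto_congr' (polWindow_eventuallyEq_of_eventuallyAgree F ρ bV h g k μ ν z)

/-- `WindowedNE9` transfers between eventually-agreeing term families (`Filter.eventually_congr`). [cite: Balaban1987RG1, (1.18) p.263 (bookkeeping)] -/
theorem windowedNE9_iff_of_eventuallyAgree {ℰ ℰ' : TermFamily1 F 𝔄} (h : EventuallyAgree F ℰ ℰ') (W : Set (ℕ → ℝ)) (κ : ℝ) (Λ : ℕ → ℕ → ℝ) :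
    WindowedNE9 F ℰ ρ bV W κ Λ ↔ WindowedNE9 F ℰ' ρ bV W κ Λ := by
  refine forall₂_congr fun g _ => forall₂_congr fun g' _ => forall_congr' fun k => forall₂_congr fun μ ν => forall_congr' fun z => ?_
  refine Filter.eventually_congr ?_
  filter_upwards [polWindow_eventuallyEq_of_eventuallyAgree F ρ bV h g k μ ν z, polWindow_eventuallyEq_of_eventuallyAgree F ρ bV h g' k μ ν z]
    with K hK hK'
  rw [hK, hK']

/-- `WindowedDecay` transfers between eventually-agreeing term families (`Filter.eventually_congr`). [cite: Balaban1987RG1, (5.10) p.293 (bookkeeping)] -/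
theorem windowedDecay_iff_of_eventuallyAgree {ℰ ℰ' : TermFamily1 F 𝔄} (h : EventuallyAgree F ℰ ℰ') (W : Set (ℕ → ℝ)) (μ ν : Fin 4) (κ : ℝ) :
    WindowedDecay F ℰ ρ bV W μ ν κ ↔ WindowedDecay F ℰ' ρ bV W μ ν κ := by
  refine forall₂_congr fun g _ => exists_congr fun C₀ => forall_congr' fun k => forall_congr' fun z => ?_
  refine Filter.eventually_congr ?_
  filter_upwards [polWindow_eventuallyEq_of_eventuallyAgree F ρ bV h g k μ ν z] with K hK
  rw [hK]

/-- `GeometricIncrements` passes to an eventually-agreeing term family (shift the threshold `K₀` past the agreement index; same constant).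
[cite: Balaban1987RG1, (1.21) p.264 (bookkeeping)] -/
theorem geometricIncrements_of_eventuallyAgree {ℰ ℰ' : TermFamily1 F 𝔄} (h : EventuallyAgree F ℰ ℰ') {W : Set (ℕ → ℝ)} {r : ℝ}
    (hinc : GeometricIncrements F ℰ ρ bV W r) : GeometricIncrements F ℰ' ρ bV W r := by
  intro g hg k μ ν z
  obtain ⟨K₀, C, hC⟩ := hinc g hg k μ ν z
  obtain ⟨K₁, hK₁⟩ := h k (histPrefix g k)
  refine ⟨max K₀ K₁, C, fun K hK => ?_⟩
  have h0 : K₀ ≤ K := le_of_max_le_left hK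
  have h1 : K₁ ≤ K := le_of_max_le_right hK
  rw [← hK₁ K h1, ← hK₁ (K + 1) (h1.trans (Nat.le_succ K))]
  exact hC K h0

/-- `GeometricIncrements` transfers between eventually-agreeing term families. [cite: Balaban1987RG1, (1.21) p.264 (bookkeeping)] -/
theorem geometricIncrements_iff_of_eventuallyAgree {ℰ ℰ' : TermFamily1 F 𝔄} (h : EventuallyAgree F ℰ ℰ') (W : Set (ℕ → ℝ)) (r : ℝ) :
    GeometricIncrements F ℰ ρ bV W r ↔ GeometricIncrements F ℰ' ρ bV W r :=
  ⟨geometricIncrements_of_eventuallyAgree F ρ bV h, geometricIncrements_of_eventuallyAgree F ρ bV (h.symm F)⟩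

/-- Under eventual agreement the windowed kernel sequences at a FIXED history are eventually equal. [cite: Balaban1987RG1, (1.20)–(1.21) p.264 (bookkeeping)] -/
theorem polWindow_hist_eventuallyEq_of_eventuallyAgree {ℰ ℰ' : TermFamily1 F 𝔄} (h : EventuallyAgree F ℰ ℰ') (k : ℕ) (v : Fin (k + 1) → ℝ)
    (μ ν : Fin 4) (z : Fin 4 → ℤ) :
    (fun K : ℕ => polWindow F K (k + 1) (ℰ k v K) ρ bV μ ν z) =ᶠ[atTop] (fun K : ℕ => polWindow F K (k + 1) (ℰ' k v K) ρ bV μ ν z) := by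
  obtain ⟨K₀, hK⟩ := h k v
  exact Filter.eventually_atTop.2 ⟨K₀, fun K hKK => by simp only [hK K hKK]⟩

/-- `PolLimitsExistBox` transfers between eventually-agreeing term families. [cite: Balaban1987RG1, (1.21) p.264 (bookkeeping)] -/
theorem polLimitsExistBox_iff_of_eventuallyAgree {ℰ ℰ' : TermFamily1 F 𝔄} (h : EventuallyAgree F ℰ ℰ') (γ : ℝ) :
    PolLimitsExistBox F ℰ ρ bV γ ↔ PolLimitsExistBox F ℰ' ρ bV γ := by
  refine forall₂_congr fun k v => forall_congr' fun _ => forall₂_congr fun μ ν => forall_congr' fun z => exists_congr fun P => ?_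
  exact Filter.tendsto_congr' (polWindow_hist_eventuallyEq_of_eventuallyAgree F ρ bV h k v μ ν z)

/-- `WindowedStepRate` transfers between eventually-agreeing term families (both runs' sequences are eventually equal; `K + s ≥ K`).
[cite: Balaban1987RG1, Thm 1 p.259 (bookkeeping)] -/
theorem windowedStepRate_iff_of_eventuallyAgree {ℰ ℰ' : TermFamily1 F 𝔄} (h : EventuallyAgree F ℰ ℰ') (γ : ℝ) (s : ℕ) (κ θ C' : ℝ) :
    WindowedStepRate F ℰ ρ bV γ s κ θ C' ↔ WindowedStepRate F ℰ' ρ bV γ s κ θ C' := by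
  refine forall₂_congr fun k w => forall_congr' fun _ => forall₂_congr fun μ ν => forall_congr' fun x => ?_
  refine Filter.eventually_congr ?_
  obtain ⟨K₁, hK₁⟩ := h (k + 1) w
  obtain ⟨K₂, hK₂⟩ := h k (Fin.tail w)
  filter_upwards [Filter.eventually_ge_atTop (max K₁ K₂)] with K hK
  rw [hK₁ (K + s) ((le_of_max_le_left hK).trans (Nat.le_add_right K s)), hK₂ K (le_of_max_le_right hK)]

/-- `KernelStepRate` transfers between eventually-agreeing term families (their limiting kernels agree, W1-20 `kernelA_congr_of_eventuallyAgree`).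
[cite: Balaban1987RG1, (1.21) p.264 (bookkeeping)] -/
theorem kernelStepRate_iff_of_eventuallyAgree {ℰ ℰ' : TermFamily1 F 𝔄} (h : EventuallyAgree F ℰ ℰ') (γ κ θ C₅ : ℝ) :
    KernelStepRate F ℰ ρ bV γ κ θ C₅ ↔ KernelStepRate F ℰ' ρ bV γ κ θ C₅ := by
  simp only [KernelStepRate, LocalizedSum17.kernelA_congr_of_eventuallyAgree F ρ bV h]

end Generic

/-! ## §2. The letters at the record, Stage 13, and their reading-side faces -/

section Record

open scoped Matrix.Norms.L2Operator

variable (F : T4Family) (N : ℕ) [NeZero N] {𝔸 : Type*} {M : ℕ}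

/-- **(1.21) EXISTS ON THE WINDOW OF RECORD** for the merged term family of record in the record's β-chart (binder).
[cite: Balaban1987RG1, (1.21) p.264] -/
def PolLimitsExistOfRecord₁₃ (θ : Stage13Params F N) : Prop :=
  letI := θ.instVβ₁; letI := θ.instVβ₂; letI := θ.instιβ
  PolLimitsExist F (mergedTermFamilyMatT F N (TβOfRecord₁₃ F N) (chiβOfRecord₁₃ F N θ) θ.εbg) θ.ρ8 θ.bV (Window θ.γ)

/-- Face (`Iff.rfl`): the letter IS the raw existence hypothesis the Summit-side kernel producers display at the objects of record.
[cite: Balaban1987RG1, (1.21) p.264 (bookkeeping)] -/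
theorem polLimitsExistOfRecord₁₃_iff (θ : Stage13Params F N) :
    PolLimitsExistOfRecord₁₃ F N θ ↔
      (letI := θ.instVβ₁; letI := θ.instVβ₂; letI := θ.instιβ
       ∀ g ∈ Window θ.γ, ∀ j : ℕ,
        PolLimitExists F (j + 1) (fun K => mergedTermFamilyMatT F N (TβOfRecord₁₃ F N) (chiβOfRecord₁₃ F N θ) θ.εbg j (histPrefix g j) K) θ.ρ8 θ.bV) :=
  Iff.rfl

/-- **WINDOWED NE9 OF RECORD** at rate `κ` and moduli `Λ` (binder; free parameters — a consumer instantiates `ℓ.κ ∕ ℓ.moduli` of a letter block).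
[cite: Balaban1987RG1, (1.18) p.263 and (1.20) p.264] -/
def WindowedNE9OfRecord₁₃ (θ : Stage13Params F N) (κ : ℝ) (Λ : ℕ → ℕ → ℝ) : Prop :=
  letI := θ.instVβ₁; letI := θ.instVβ₂; letI := θ.instιβ
  WindowedNE9 F (mergedTermFamilyMatT F N (TβOfRecord₁₃ F N) (chiβOfRecord₁₃ F N θ) θ.εbg) θ.ρ8 θ.bV (Window θ.γ) κ Λ

/-- Face (`Iff.rfl`): the letter IS the raw windowed joint history-Lipschitz hypothesis the Summit-side N22 producer displays at the objects of record.
[cite: Balaban1987RG1, (1.18) p.263 (bookkeeping)] -/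
theorem windowedNE9OfRecord₁₃_iff (θ : Stage13Params F N) (κ : ℝ) (Λ : ℕ → ℕ → ℝ) :
    WindowedNE9OfRecord₁₃ F N θ κ Λ ↔
      (letI := θ.instVβ₁; letI := θ.instVβ₂; letI := θ.instιβ
       ∀ g ∈ Window θ.γ, ∀ g' ∈ Window θ.γ, ∀ (j : ℕ) (μ ν : Fin 4) (z : Fin 4 → ℤ), ∀ᶠ K in atTop,
        |polWindow F K (j + 1) (mergedTermFamilyMatT F N (TβOfRecord₁₃ F N) (chiβOfRecord₁₃ F N θ) θ.εbg j (histPrefix g j) K) θ.ρ8 θ.bV μ ν z -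
            polWindow F K (j + 1) (mergedTermFamilyMatT F N (TβOfRecord₁₃ F N) (chiβOfRecord₁₃ F N θ) θ.εbg j (histPrefix g' j) K) θ.ρ8 θ.bV μ ν z| ≤
          Real.exp (-(κ * l1 z)) * ∑ i ∈ Finset.range (j + 1), Λ (j + 1) i * |g i - g' i|) :=
  Iff.rfl

/-- The `∀ K` form of windowed NE9 of record (binder). [cite: Balaban1987RG1, (1.18) p.263 and (1.20) p.264] -/
def WindowedNE9ForallOfRecord₁₃ (θ : Stage13Params F N) (κ : ℝ) (Λ : ℕ → ℕ → ℝ) : Prop :=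
  letI := θ.instVβ₁; letI := θ.instVβ₂; letI := θ.instιβ
  WindowedNE9Forall F (mergedTermFamilyMatT F N (TβOfRecord₁₃ F N) (chiβOfRecord₁₃ F N θ) θ.εbg) θ.ρ8 θ.bV (Window θ.γ) κ Λ

/-- The `∀ K` form of record gives the eventual form of record. [cite: Balaban1987RG1, (1.18) p.263 (bookkeeping)] -/
theorem WindowedNE9ForallOfRecord₁₃.windowedNE9OfRecord₁₃ {θ : Stage13Params F N} {κ : ℝ} {Λ : ℕ → ℕ → ℝ}
    (h : WindowedNE9ForallOfRecord₁₃ F N θ κ Λ) : WindowedNE9OfRecord₁₃ F N θ κ Λ := by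
  letI := θ.instVβ₁; letI := θ.instVβ₂; letI := θ.instιβ
  exact WindowedNE9Forall.windowedNE9 F _ θ.ρ8 θ.bV h

/-- **WINDOWED (5.10) DECAY OF RECORD** at directions `(μ, ν)` and rate `κ` (binder). [cite: Balaban1987RG1, (5.10) p.293 and (1.20) p.264] -/
def WindowedDecayOfRecord₁₃ (θ : Stage13Params F N) (μ ν : Fin 4) (κ : ℝ) : Prop :=
  letI := θ.instVβ₁; letI := θ.instVβ₂; letI := θ.instιβ
  WindowedDecay F (mergedTermFamilyMatT F N (TβOfRecord₁₃ F N) (chiβOfRecord₁₃ F N θ) θ.εbg) θ.ρ8 θ.bV (Window θ.γ) μ ν κ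

/-- Face (`Iff.rfl`): the letter IS the raw windowed (5.10) hypothesis a Summit-side (D4) producer displays at the objects of record.
[cite: Balaban1987RG1, (5.10) p.293 (bookkeeping)] -/
theorem windowedDecayOfRecord₁₃_iff (θ : Stage13Params F N) (μ ν : Fin 4) (κ : ℝ) :
    WindowedDecayOfRecord₁₃ F N θ μ ν κ ↔
      (letI := θ.instVβ₁; letI := θ.instVβ₂; letI := θ.instιβ
       ∀ g ∈ Window θ.γ, ∃ C₀ : ℝ, ∀ (j : ℕ) (z : Fin 4 → ℤ), ∀ᶠ K in atTop,
        |polWindow F K (j + 1) (mergedTermFamilyMatT F N (TβOfRecord₁₃ F N) (chiβOfRecord₁₃ F N θ) θ.εbg j (histPrefix g j) K) θ.ρ8 θ.bV μ ν z| ≤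
          C₀ * Real.exp (-κ * l1 z)) :=
  Iff.rfl

/-- **GEOMETRIC INCREMENTS OF RECORD** at ratio `r` (binder). [cite: Balaban1987RG1, (1.21) p.264] -/
def GeometricIncrementsOfRecord₁₃ (θ : Stage13Params F N) (r : ℝ) : Prop :=
  letI := θ.instVβ₁; letI := θ.instVβ₂; letI := θ.instιβ
  GeometricIncrements F (mergedTermFamilyMatT F N (TβOfRecord₁₃ F N) (chiβOfRecord₁₃ F N θ) θ.εbg) θ.ρ8 θ.bV (Window θ.γ) r

/-- Face (`Iff.rfl`). [cite: Balaban1987RG1, (1.21) p.264 (bookkeeping)] -/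
theorem geometricIncrementsOfRecord₁₃_iff (θ : Stage13Params F N) (r : ℝ) :
    GeometricIncrementsOfRecord₁₃ F N θ r ↔
      (letI := θ.instVβ₁; letI := θ.instVβ₂; letI := θ.instιβ
       ∀ g ∈ Window θ.γ, ∀ (j : ℕ) (μ ν : Fin 4) (z : Fin 4 → ℤ), ∃ (K₀ : ℕ) (C : ℝ), ∀ K ≥ K₀,
        |polWindow F (K + 1) (j + 1) (mergedTermFamilyMatT F N (TβOfRecord₁₃ F N) (chiβOfRecord₁₃ F N θ) θ.εbg j (histPrefix g j) (K + 1)) θ.ρ8 θ.bV μ ν z -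
            polWindow F K (j + 1) (mergedTermFamilyMatT F N (TβOfRecord₁₃ F N) (chiβOfRecord₁₃ F N θ) θ.εbg j (histPrefix g j) K) θ.ρ8 θ.bV μ ν z| ≤ C * r ^ K) :=
  Iff.rfl

/-- **(1.21) EXISTS ON THE BOXES OF RECORD** (binder, box form). [cite: Balaban1987RG1, (1.21) p.264] -/
def PolLimitsExistBoxOfRecord₁₃ (θ : Stage13Params F N) : Prop :=
  letI := θ.instVβ₁; letI := θ.instVβ₂; letI := θ.instιβ
  PolLimitsExistBox F (mergedTermFamilyMatT F N (TβOfRecord₁₃ F N) (chiβOfRecord₁₃ F N θ) θ.εbg) θ.ρ8 θ.bV θ.γ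

/-- Face (`Iff.rfl`): the letter IS the raw box-form existence hypothesis node N18's kernel producer displays at the objects of record.
[cite: Balaban1987RG1, (1.21) p.264 (bookkeeping)] -/
theorem polLimitsExistBoxOfRecord₁₃_iff (θ : Stage13Params F N) :
    PolLimitsExistBoxOfRecord₁₃ F N θ ↔
      (letI := θ.instVβ₁; letI := θ.instVβ₂; letI := θ.instιβ
       ∀ (k : ℕ) (v : Fin (k + 1) → ℝ), v ∈ Box θ.γ k →
        PolLimitExists F (k + 1) (fun K => mergedTermFamilyMatT F N (TβOfRecord₁₃ F N) (chiβOfRecord₁₃ F N θ) θ.εbg k v K) θ.ρ8 θ.bV) :=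
  Iff.rfl

/-- The window letter of record gives the box letter of record. [cite: Balaban1987RG1, (1.21) p.264 (bookkeeping)] -/
theorem PolLimitsExistOfRecord₁₃.box {θ : Stage13Params F N} (h : PolLimitsExistOfRecord₁₃ F N θ) : PolLimitsExistBoxOfRecord₁₃ F N θ := by
  letI := θ.instVβ₁; letI := θ.instVβ₂; letI := θ.instιβ
  exact PolLimitsExist.box F _ θ.ρ8 θ.bV h

/-- **WINDOWED TWO-RUN STEP RATE OF RECORD** on the boxes `]0, θ.γ]^{k+2}` with run offset `s`, rate `κ`, ratio `θ₅`, constant `C₅` (binder; free parameters —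
node N18's producer instantiates `ℓ.κ ∕ ℓ.θ₅ ∕ ℓ.C₅`). [cite: Balaban1987RG1, Thm 1 p.259 and (1.20)–(1.21) p.264] -/
def WindowedStepRateOfRecord₁₃ (θ : Stage13Params F N) (s : ℕ) (κ θ₅ C' : ℝ) : Prop :=
  letI := θ.instVβ₁; letI := θ.instVβ₂; letI := θ.instιβ
  WindowedStepRate F (mergedTermFamilyMatT F N (TβOfRecord₁₃ F N) (chiβOfRecord₁₃ F N θ) θ.εbg) θ.ρ8 θ.bV θ.γ s κ θ₅ C'

/-- Face (`Iff.rfl`): the letter IS the raw finite-volume two-run rate hypothesis node N18's kernel producer displays at the objects of record.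
[cite: Balaban1987RG1, Thm 1 p.259 (bookkeeping)] -/
theorem windowedStepRateOfRecord₁₃_iff (θ : Stage13Params F N) (s : ℕ) (κ θ₅ C' : ℝ) :
    WindowedStepRateOfRecord₁₃ F N θ s κ θ₅ C' ↔
      (letI := θ.instVβ₁; letI := θ.instVβ₂; letI := θ.instιβ
       ∀ (k : ℕ) (w : Fin (k + 2) → ℝ), w ∈ Box θ.γ (k + 1) → ∀ (μ ν : Fin 4) (x : Fin 4 → ℤ), ∀ᶠ K in atTop,
        |polWindow F (K + s) (k + 1 + 1) (mergedTermFamilyMatT F N (TβOfRecord₁₃ F N) (chiβOfRecord₁₃ F N θ) θ.εbg (k + 1) w (K + s)) θ.ρ8 θ.bV μ ν x -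
            polWindow F K (k + 1) (mergedTermFamilyMatT F N (TβOfRecord₁₃ F N) (chiβOfRecord₁₃ F N θ) θ.εbg k (Fin.tail w) K) θ.ρ8 θ.bV μ ν x| ≤
          C' * θ₅ ^ k * Real.exp (-κ * l1 x)) :=
  Iff.rfl

/-- **KERNEL STEP RATE OF RECORD** at rate `κ`, ratio `θ₅`, constant `C₅` (binder, limiting kernels of the merged term family of record; node N18's producer
instantiates `ℓ.κ ∕ ℓ.θ₅ ∕ ℓ.C₅`). [cite: Balaban1987RG1, Thm 1 p.259 and (1.20)–(1.22) p.264] -/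
def KernelStepRateOfRecord₁₃ (θ : Stage13Params F N) (κ θ₅ C₅ : ℝ) : Prop :=
  letI := θ.instVβ₁; letI := θ.instVβ₂; letI := θ.instιβ
  KernelStepRate F (mergedTermFamilyMatT F N (TβOfRecord₁₃ F N) (chiβOfRecord₁₃ F N θ) θ.εbg) θ.ρ8 θ.bV θ.γ κ θ₅ C₅

/-- Face (`Iff.rfl`): the letter IS the right-hand side of node N18's `…_iff_kernelStepRate` at the kernel objects of record (free `κ θ₅ C₅`).
[cite: Balaban1987RG1, Thm 1 p.259 (bookkeeping)] -/
theorem kernelStepRateOfRecord₁₃_iff (θ : Stage13Params F N) (κ θ₅ C₅ : ℝ) :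
    KernelStepRateOfRecord₁₃ F N θ κ θ₅ C₅ ↔
      (letI := θ.instVβ₁; letI := θ.instVβ₂; letI := θ.instιβ
       ∀ b : ℝ, 0 < b → b ≤ θ.γ → ∀ g ∈ Window θ.γ, ∀ (j : ℕ) (μ ν : Fin 4) (z : Fin 4 → ℤ),
        |kernelA F (mergedTermFamilyMatT F N (TβOfRecord₁₃ F N) (chiβOfRecord₁₃ F N θ) θ.εbg) θ.ρ8 θ.bV g j μ ν z -
            kernelA F (mergedTermFamilyMatT F N (TβOfRecord₁₃ F N) (chiβOfRecord₁₃ F N θ) θ.εbg) θ.ρ8 θ.bV (prependCoupling b g) (j + 1) μ ν z| ≤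
          C₅ * θ₅ ^ (j + 1) * Real.exp (-(κ * l1 z))) :=
  Iff.rfl

/-- The letter of record IS W1-19's `NE5` at the kernel objects of record for every member `b ∈ ]0, θ.γ]`. [cite: Balaban1987RG1, Thm 1 p.259 (bookkeeping)] -/
theorem kernelStepRateOfRecord₁₃_iff_forall_ne5 (θ : Stage13Params F N) (κ θ₅ C₅ : ℝ) :
    KernelStepRateOfRecord₁₃ F N θ κ θ₅ C₅ ↔
      (letI := θ.instVβ₁; letI := θ.instVβ₂; letI := θ.instιβ
       ∀ b : ℝ, 0 < b → b ≤ θ.γ →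
        NE5 (EA F (mergedTermFamilyMatT F N (TβOfRecord₁₃ F N) (chiβOfRecord₁₃ F N θ) θ.εbg) θ.ρ8 θ.bV)
          (EB F (mergedTermFamilyMatT F N (TβOfRecord₁₃ F N) (chiβOfRecord₁₃ F N θ) θ.εbg) θ.ρ8 θ.bV b) (Window θ.γ) κ θ₅ C₅) := by
  letI := θ.instVβ₁; letI := θ.instVβ₂; letI := θ.instιβ
  exact kernelStepRate_iff_forall_ne5 F _ θ.ρ8 θ.bV θ.γ κ θ₅ C₅

/-- READING SIDE: under W1-20's law at the record, (1.21)-existence of record ⟺ (1.21)-existence for the W1 reading's localized sum.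
[cite: Balaban1987RG1, (1.7) p.261 and (1.21) p.264; Balaban1988RG2Cluster, (2.14) p.15] -/
theorem polLimitsExistOfRecord₁₃_iff_of_localizes (θ : Stage13Params F N) (S : (K : ℕ) → ClusterTower (F.P K) 𝔸 M)
    (emb : ReadingMaps F (MatA N) 𝔸) (h : Localizes17OfRecord₁₃ F N θ S emb) :
    PolLimitsExistOfRecord₁₃ F N θ ↔
      (letI := θ.instVβ₁; letI := θ.instVβ₂; letI := θ.instιβ
       PolLimitsExist F (localizedSum F S emb) θ.ρ8 θ.bV (Window θ.γ)) := by
  letI := θ.instVβ₁; letI := θ.instVβ₂; letI := θ.instιβ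
  exact polLimitsExist_iff_of_eventuallyAgree F θ.ρ8 θ.bV (h.eventuallyAgree F) (Window θ.γ)

/-- READING SIDE: under W1-20's law at the record, windowed NE9 of record ⟺ windowed NE9 for the W1 reading's localized sum.
[cite: Balaban1987RG1, (1.7) p.261 and (1.18) p.263; Balaban1988RG2Cluster, (2.14) p.15] -/
theorem windowedNE9OfRecord₁₃_iff_of_localizes (θ : Stage13Params F N) (S : (K : ℕ) → ClusterTower (F.P K) 𝔸 M)
    (emb : ReadingMaps F (MatA N) 𝔸) (h : Localizes17OfRecord₁₃ F N θ S emb) (κ : ℝ) (Λ : ℕ → ℕ → ℝ) :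
    WindowedNE9OfRecord₁₃ F N θ κ Λ ↔
      (letI := θ.instVβ₁; letI := θ.instVβ₂; letI := θ.instιβ
       WindowedNE9 F (localizedSum F S emb) θ.ρ8 θ.bV (Window θ.γ) κ Λ) := by
  letI := θ.instVβ₁; letI := θ.instVβ₂; letI := θ.instιβ
  exact windowedNE9_iff_of_eventuallyAgree F θ.ρ8 θ.bV (h.eventuallyAgree F) (Window θ.γ) κ Λ

/-- READING SIDE: under W1-20's law at the record, windowed (5.10) decay of record ⟺ the same for the W1 reading's localized sum.
[cite: Balaban1987RG1, (1.7) p.261 and (5.10) p.293; Balaban1988RG2Cluster, (2.14) p.15] -/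
theorem windowedDecayOfRecord₁₃_iff_of_localizes (θ : Stage13Params F N) (S : (K : ℕ) → ClusterTower (F.P K) 𝔸 M)
    (emb : ReadingMaps F (MatA N) 𝔸) (h : Localizes17OfRecord₁₃ F N θ S emb) (μ ν : Fin 4) (κ : ℝ) :
    WindowedDecayOfRecord₁₃ F N θ μ ν κ ↔
      (letI := θ.instVβ₁; letI := θ.instVβ₂; letI := θ.instιβ
       WindowedDecay F (localizedSum F S emb) θ.ρ8 θ.bV (Window θ.γ) μ ν κ) := by
  letI := θ.instVβ₁; letI := θ.instVβ₂; letI := θ.instιβ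
  exact windowedDecay_iff_of_eventuallyAgree F θ.ρ8 θ.bV (h.eventuallyAgree F) (Window θ.γ) μ ν κ

/-- READING SIDE: under W1-20's law at the record, geometric increments of record ⟺ the same for the W1 reading's localized sum.
[cite: Balaban1987RG1, (1.7) p.261 and (1.21) p.264; Balaban1988RG2Cluster, (2.14) p.15] -/
theorem geometricIncrementsOfRecord₁₃_iff_of_localizes (θ : Stage13Params F N) (S : (K : ℕ) → ClusterTower (F.P K) 𝔸 M)
    (emb : ReadingMaps F (MatA N) 𝔸) (h : Localizes17OfRecord₁₃ F N θ S emb) (r : ℝ) :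
    GeometricIncrementsOfRecord₁₃ F N θ r ↔
      (letI := θ.instVβ₁; letI := θ.instVβ₂; letI := θ.instιβ
       GeometricIncrements F (localizedSum F S emb) θ.ρ8 θ.bV (Window θ.γ) r) := by
  letI := θ.instVβ₁; letI := θ.instVβ₂; letI := θ.instιβ
  exact geometricIncrements_iff_of_eventuallyAgree F θ.ρ8 θ.bV (h.eventuallyAgree F) (Window θ.γ) r

/-- READING SIDE: under W1-20's law at the record, box-form (1.21)-existence of record ⟺ the same for the W1 reading's localized sum.
[cite: Balaban1987RG1, (1.7) p.261 and (1.21) p.264; Balaban1988RG2Cluster, (2.14) p.15] -/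
theorem polLimitsExistBoxOfRecord₁₃_iff_of_localizes (θ : Stage13Params F N) (S : (K : ℕ) → ClusterTower (F.P K) 𝔸 M)
    (emb : ReadingMaps F (MatA N) 𝔸) (h : Localizes17OfRecord₁₃ F N θ S emb) :
    PolLimitsExistBoxOfRecord₁₃ F N θ ↔
      (letI := θ.instVβ₁; letI := θ.instVβ₂; letI := θ.instιβ
       PolLimitsExistBox F (localizedSum F S emb) θ.ρ8 θ.bV θ.γ) := by
  letI := θ.instVβ₁; letI := θ.instVβ₂; letI := θ.instιβ
  exact polLimitsExistBox_iff_of_eventuallyAgree F θ.ρ8 θ.bV (h.eventuallyAgree F) θ.γ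

/-- READING SIDE: under W1-20's law at the record, the windowed two-run step rate of record ⟺ the same for the W1 reading's localized sum.
[cite: Balaban1987RG1, (1.7) p.261 and Thm 1 p.259; Balaban1988RG2Cluster, (2.14) p.15] -/
theorem windowedStepRateOfRecord₁₃_iff_of_localizes (θ : Stage13Params F N) (S : (K : ℕ) → ClusterTower (F.P K) 𝔸 M)
    (emb : ReadingMaps F (MatA N) 𝔸) (h : Localizes17OfRecord₁₃ F N θ S emb) (s : ℕ) (κ θ₅ C' : ℝ) :
    WindowedStepRateOfRecord₁₃ F N θ s κ θ₅ C' ↔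
      (letI := θ.instVβ₁; letI := θ.instVβ₂; letI := θ.instιβ
       WindowedStepRate F (localizedSum F S emb) θ.ρ8 θ.bV θ.γ s κ θ₅ C') := by
  letI := θ.instVβ₁; letI := θ.instVβ₂; letI := θ.instιβ
  exact windowedStepRate_iff_of_eventuallyAgree F θ.ρ8 θ.bV (h.eventuallyAgree F) θ.γ s κ θ₅ C'

/-- READING SIDE: under W1-20's law at the record, the kernel step rate of record ⟺ the same for the W1 reading's localized sum.
[cite: Balaban1987RG1, (1.7) p.261 and Thm 1 p.259; Balaban1988RG2Cluster, (2.14) p.15] -/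
theorem kernelStepRateOfRecord₁₃_iff_of_localizes (θ : Stage13Params F N) (S : (K : ℕ) → ClusterTower (F.P K) 𝔸 M)
    (emb : ReadingMaps F (MatA N) 𝔸) (h : Localizes17OfRecord₁₃ F N θ S emb) (κ θ₅ C₅ : ℝ) :
    KernelStepRateOfRecord₁₃ F N θ κ θ₅ C₅ ↔
      (letI := θ.instVβ₁; letI := θ.instVβ₂; letI := θ.instιβ
       KernelStepRate F (localizedSum F S emb) θ.ρ8 θ.bV θ.γ κ θ₅ C₅) := by
  letI := θ.instVβ₁; letI := θ.instVβ₂; letI := θ.instιβ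
  exact kernelStepRate_iff_of_eventuallyAgree F θ.ρ8 θ.bV (h.eventuallyAgree F) θ.γ κ θ₅ C₅

end Record

end Literature.MathematicalPhysics.QuantumFieldTheory.Balaban1983to89.Node00.U3KernelLetters
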